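import Literature.AnabelianGeometry.SemiGraphs.CoveringHomCanPointAlignment
import Literature.AnabelianGeometry.SemiGraphs.CoveringHomCanonicalEq
import Literature.AnabelianGeometry.SemiGraphs.BranchAlignedCriterion
import Literature.AnabelianGeometry.Anabelioids.FiniteEtaleLocalDictionaryStabilizer
import Literature.AnabelianGeometry.Anabelioids.ComponentsOrbits

/-!
# The covering `𝒢_A → 𝒢` attached to an object of `B(𝒢)` is branch-aligned ([SemiAnbd] §2 p. 23)

Mochizuki, *Semi-graphs of anabelioids*, Publ. RIMS **42** (2006) 221–322, §2 p. 23
[cite: MochizukiSemiAnbd2006, Def. 2.2(i) p.23].  abc-iut cell, layer L3, DISCHARGE-L3 §G row G25-G9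
(abc-iut-L4-t17; finding L4t17-F1 / ruling μ2), part 2 of 2: for abc-iut-L3-t5's construction
`coveringHomCan A : 𝒢_A → 𝒢` the predicate `Hom.IsBranchAligned` (`FiniteEtaleCoveringGlobalDef`)
HOLDS (`coveringHomCan_isBranchAligned`) — the third conjunct of the covering notion of record
`local ∧ global ∧ branch-aligned ∧ vertex-aligned`.

Clause (i) is abc-iut-L6-d5's point criterion `comap_alignedBranchSubgroup_le_of_point` fed with
`Π_{(v,P)} ⊆ Stab(s₀)`, `Stab(t₀) ⊆ Π_{(e,Q)}` (abc-iut-L6-t17's `range_pi1Map_le/eq_stabilizer`) and the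
point alignment of part 1 (`alignIso_point`).  Clause (ii): if the transport element of two distinct
branches `(b, Q₁) ≠ (b, Q₂)` at `(v, P)` were `β · ι(u)`, evaluating both sides at `s₀` (fixed by
`ι(u)`; `β ∈ Π_{b,1}^{al}`; point alignment for both branches) gives a point of the fibre of `b^* P`
in the images of both `Q₁` and `Q₂`, hence a common fibre point of two distinct connected components
of `T_e` — impossible (`component_eq_of_mem_range`).  Nothing here takes a side on [IUTchIII]
Cor. 3.12; typed ≠ discharged.
-/

namespace Literature.AnabelianGeometry.SemiGraphs

open CategoryTheory CategoryTheory.Limits CategoryTheory.PreGaloisCategory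
open Literature.AnabelianGeometry.Anabelioids

universe v₁ u₁ u

-- Mathlib's `Over.pullback` / `Over.star` simp lemmas only fire under the pre-v4.2x defeq
-- transparency behaviour (as in `CoveringHomCanonical.lean`).
set_option backward.isDefEq.respectTransparency false

namespace SemiGraphOfAnabelioids

namespace BObj

variable {𝒢 : SemiGraphOfAnabelioids.{v₁, u₁, u}} (A : 𝒢.BObj)

/-! ### Base points of the constituents of `𝒢_A` -/

/-- A point of the (one-point) fibre of the model of `P = P` at any basepoint `F′` of `(𝒢_v)_P`.
[cite: MochizukiSemiAnbd2006, Def. 2.2(i) p.23] -/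
theorem nonempty_fiber_mkId_vModel (vc : A.fibreData.total.Vertex)
    (F' : A.coveringGraph.V vc ⥤ FintypeCat.{v₁}) [FiberFunctor F'] :
    Nonempty (F'.obj ((Shrink.equivalence
      (Over ((A.vComp vc).1 : 𝒢.V (A.fibreData.proj.vertexMap vc)))).functor.obj (Over.mk (𝟙 _)))) := by
  have hT : IsTerminal (C := A.coveringGraph.V vc) ((Shrink.equivalence
      (Over ((A.vComp vc).1 : 𝒢.V (A.fibreData.proj.vertexMap vc)))).functor.obj (Over.mk (𝟙 _))) :=
    Over.mkIdTerminal.isTerminalObj ((Shrink.equivalence (Over ((A.vComp vc).1 :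
      𝒢.V (A.fibreData.proj.vertexMap vc)))).functor : _ ⥤ A.coveringGraph.V vc) _
  obtain ⟨e⟩ := nonempty_equiv_fiber_terminal_punit F'
  exact ⟨(FintypeCat.equivEquivIso.symm (F'.mapIso
    (hT.uniqueUpToIso (terminalIsTerminal (C := A.coveringGraph.V vc))))).symm (e.symm PUnit.unit)⟩

/-- A point of the fibre of the model of `Q = Q` at any basepoint `F_e′` of `(𝒢_e)_Q`.
[cite: MochizukiSemiAnbd2006, Def. 2.2(i) p.23] -/
theorem nonempty_fiber_mkId_eModel (ec : A.fibreData.total.Edge)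
    (Fe' : A.coveringGraph.E ec ⥤ FintypeCat.{v₁}) [FiberFunctor Fe'] :
    Nonempty (Fe'.obj ((Shrink.equivalence
      (Over ((A.eComp ec).1 : 𝒢.E (A.fibreData.proj.edgeMap ec)))).functor.obj (Over.mk (𝟙 _)))) := by
  have hT : IsTerminal (C := A.coveringGraph.E ec) ((Shrink.equivalence
      (Over ((A.eComp ec).1 : 𝒢.E (A.fibreData.proj.edgeMap ec)))).functor.obj (Over.mk (𝟙 _))) :=
    Over.mkIdTerminal.isTerminalObj ((Shrink.equivalence (Over ((A.eComp ec).1 :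
      𝒢.E (A.fibreData.proj.edgeMap ec)))).functor : _ ⥤ A.coveringGraph.E ec) _
  obtain ⟨e⟩ := nonempty_equiv_fiber_terminal_punit Fe'
  exact ⟨(FintypeCat.equivEquivIso.symm (Fe'.mapIso
    (hT.uniqueUpToIso (terminalIsTerminal (C := A.coveringGraph.E ec))))).symm (e.symm PUnit.unit)⟩

/-- **`Π_{(v,P)} ⊆ Stab(s₀)`** for `coveringHomCan`: the image of `π₁` of the vertex component
`(𝒢_v)_P → 𝒢_v` at a basepoint `F′` fixes the canonical base point `s₀ = F′(Δ_P)(t)`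
(abc-iut-L6-t17's `range_pi1Map_le_stabilizer`, instantiated). [cite: MochizukiSemiAnbd2006, Rem. 2.2.1 p.24] -/
theorem range_pi1Map_vertexHom_le_stabilizer (vc : A.fibreData.total.Vertex)
    (F' : A.coveringGraph.V vc ⥤ FintypeCat.{v₁}) [FiberFunctor F']
    (t : F'.obj ((Shrink.equivalence
      (Over ((A.vComp vc).1 : 𝒢.V (A.fibreData.proj.vertexMap vc)))).functor.obj (Over.mk (𝟙 _)))) :
    (pi1Map (A.coveringHomCan.φV vc).pullback F').range ≤
      MulAction.stabilizer (Aut ((A.coveringHomCan.φV vc).pullback ⋙ F'))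
        (α := ((A.coveringHomCan.φV vc).pullback ⋙ F').obj ((A.vComp vc).1 : 𝒢.V (A.fibreData.proj.vertexMap vc)))
        (F'.map ((Shrink.equivalence
          (Over ((A.vComp vc).1 : 𝒢.V (A.fibreData.proj.vertexMap vc)))).functor.map
            (diagSection _)) t) := by
  have h := range_pi1Map_le_stabilizer (D := A.coveringGraph.V vc)
    (Shrink.equivalence (Over ((A.vComp vc).1 : 𝒢.V (A.fibreData.proj.vertexMap vc)))).functor
    (Q := (A.coveringHomCan.φV vc).pullback) (Iso.refl _) F' (Iso.refl _) t
  have hid : (Aut.autMulEquivOfIso (Iso.refl ((A.coveringHomCan.φV vc).pullback ⋙ F'))).toMonoidHom =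
      MonoidHom.id _ :=
    MonoidHom.ext fun σ => Iso.ext (by simp [Aut.autMulEquivOfIso])
  rw [hid, MonoidHom.id_comp, ← diagSection_eq_unit] at h
  erw [Category.comp_id] at h
  exact h

/-- **`Stab(t₀) ⊆ Π_{(e,Q)}`** for `coveringHomCan`: the image of `π₁` of the edge component
`(𝒢_e)_Q → 𝒢_e` at a basepoint `F_e′` contains the stabiliser of the canonical base point
`t₀ = F_e′(Δ_Q)(t′)` (abc-iut-L6-t17's `range_pi1Map_eq_stabilizer`). [cite: MochizukiSemiAnbd2006, Rem. 2.2.1 p.24] -/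
theorem stabilizer_le_range_pi1Map_edgeHom (bc : A.fibreData.total.Branch)
    (Fe' : A.coveringGraph.E (A.fibreData.total.edgeOf bc) ⥤ FintypeCat.{v₁}) [FiberFunctor Fe']
    (t' : Fe'.obj ((Shrink.equivalence (Over ((A.brComp bc).1 :
      𝒢.E (𝒢.graph.edgeOf (A.fibreData.proj.branchMap bc))))).functor.obj (Over.mk (𝟙 _)))) :
    MulAction.stabilizer (Aut ((A.coveringHomCan.φE (A.fibreData.total.edgeOf bc)
        (𝒢.graph.edgeOf (A.fibreData.proj.branchMap bc)) (A.fibreData.proj.edgeOf_branchMap bc).symm).pullback ⋙ Fe'))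
        (α := ((A.coveringHomCan.φE (A.fibreData.total.edgeOf bc)
            (𝒢.graph.edgeOf (A.fibreData.proj.branchMap bc)) (A.fibreData.proj.edgeOf_branchMap bc).symm).pullback ⋙
              Fe').obj ((A.brComp bc).1 : 𝒢.E (𝒢.graph.edgeOf (A.fibreData.proj.branchMap bc))))
        (Fe'.map ((Shrink.equivalence (Over ((A.brComp bc).1 :
          𝒢.E (𝒢.graph.edgeOf (A.fibreData.proj.branchMap bc))))).functor.map (diagSection _)) t') ≤
      (pi1Map (A.coveringHomCan.φE (A.fibreData.total.edgeOf bc)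
        (𝒢.graph.edgeOf (A.fibreData.proj.branchMap bc)) (A.fibreData.proj.edgeOf_branchMap bc).symm).pullback
          Fe').range := by
  haveI : PreGaloisCategory.IsConnected ((A.brComp bc).1 :
      𝒢.E (𝒢.graph.edgeOf (A.fibreData.proj.branchMap bc))) := (A.brComp bc).2
  have h := range_pi1Map_eq_stabilizer (D := A.coveringGraph.E (A.fibreData.total.edgeOf bc))
    (Shrink.equivalence (Over ((A.brComp bc).1 :
      𝒢.E (𝒢.graph.edgeOf (A.fibreData.proj.branchMap bc))))).functor
    (Q := (A.coveringHomCan.φE (A.fibreData.total.edgeOf bc)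
        (𝒢.graph.edgeOf (A.fibreData.proj.branchMap bc)) (A.fibreData.proj.edgeOf_branchMap bc).symm).pullback)
    (Iso.refl _) Fe' (Iso.refl _) t'
  have hid : (Aut.autMulEquivOfIso (Iso.refl ((A.coveringHomCan.φE (A.fibreData.total.edgeOf bc)
        (𝒢.graph.edgeOf (A.fibreData.proj.branchMap bc)) (A.fibreData.proj.edgeOf_branchMap bc).symm).pullback ⋙
          Fe'))).toMonoidHom = MonoidHom.id _ :=
    MonoidHom.ext fun σ => Iso.ext (by simp [Aut.autMulEquivOfIso])
  rw [hid, MonoidHom.id_comp, ← diagSection_eq_unit] at h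
  erw [Category.comp_id] at h
  exact h.ge

/-! ### Clause (i) -/

/-- **Clause (i) of branch alignment for `coveringHomCan`**: `ι⁻¹(Π_b^{al}) ≤ Π_{b′}` at every
branch `b′ = (b, Q)` of `𝒢_A` abutting to `v′ = (v, P)` and all basepoint data — by abc-iut-L6-d5's
point criterion and `alignIso_point`. [cite: MochizukiSemiAnbd2006, Def. 2.2(i) p.23] -/
theorem coveringHomCan_comap_alignedBranchSubgroup_le (bc : A.fibreData.total.Branch)
    (vc : A.fibreData.total.Vertex) (h' : A.fibreData.total.abuts bc = some vc)
    (F' : A.coveringGraph.V vc ⥤ FintypeCat.{v₁}) [FiberFunctor F']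
    (Fe' : A.coveringGraph.E (A.fibreData.total.edgeOf bc) ⥤ FintypeCat.{v₁}) [FiberFunctor Fe']
    (α' : (A.coveringGraph.pull bc vc h').pullback ⋙ Fe' ≅ F') :
    (A.coveringHomCan.alignedBranchSubgroup bc vc h' (A.fibreData.proj.branchMap bc) rfl F' Fe' α').comap
        (pi1Map (A.coveringHomCan.φV vc).pullback F') ≤
      A.coveringGraph.branchSubgroup F' bc h' Fe' α' := by
  obtain ⟨t⟩ := A.nonempty_fiber_mkId_vModel vc F'
  obtain ⟨t'⟩ := A.nonempty_fiber_mkId_eModel (A.fibreData.total.edgeOf bc) Fe'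
  haveI : PreGaloisCategory.IsConnected ((A.vComp vc).1 : 𝒢.V (A.fibreData.proj.vertexMap vc)) :=
    (A.vComp vc).2
  have hι : Function.Injective (pi1Map (A.coveringHomCan.φV vc).pullback F') :=
    pi1Map_injective_of_star_comp (D := A.coveringGraph.V vc)
      (Shrink.equivalence (Over ((A.vComp vc).1 : 𝒢.V (A.fibreData.proj.vertexMap vc)))).functor
      (Q := (A.coveringHomCan.φV vc).pullback) (Iso.refl _) F'
  exact comap_alignedBranchSubgroup_le_of_point A.coveringHomCan bc vc h' _ rfl F' Fe' α' hι _
    (A.range_pi1Map_vertexHom_le_stabilizer vc F' t) _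
    (A.stabilizer_le_range_pi1Map_edgeHom bc Fe' t')
    (A.inclOfLE (abuts_fst h') (A.vComp vc).1 (A.brComp bc).1 (brComp_le_branchImage h'))
    (A.alignIso_point bc vc h' F' Fe' α' t t')

/-! ### Clause (ii) and the theorem -/

/-- **The covering `coveringHomCan A : 𝒢_A → 𝒢` attached to an object `A ∈ B(𝒢)` is
BRANCH-ALIGNED** ([SemiAnbd] p. 23; finding L4t17-F1 / ruling μ2 of the abc-iut cell): clause (i)
by `coveringHomCan_comap_alignedBranchSubgroup_le`; clause (ii): if the transport element of two
distinct branches `(b, Q₁) ≠ (b, Q₂)` at `(v, P)` were `β · ι(u)`, evaluating both sides at the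
canonical base point `s₀` (fixed by `ι(u)`; `β ∈ Π_{b,1}^{al}` and point alignment for BOTH branches)
would produce a point of the fibre of `b^* P` lying in the images of both `Q₁` and `Q₂`, hence a
common fibre point of two distinct connected components of `T_e` — impossible
(`component_eq_of_mem_range`). [cite: MochizukiSemiAnbd2006, Def. 2.2(i) p.23] -/
theorem coveringHomCan_isBranchAligned : A.coveringHomCan.IsBranchAligned := by
  intro vc F' _ b
  refine ⟨fun bc h' p Fe' _ α' => ?_, ?_⟩
  · subst p
    exact A.coveringHomCan_comap_alignedBranchSubgroup_le bc vc h' F' Fe' α'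
  · intro bc₁ bc₂ h₁ h₂ p₁ p₂ hne Fe₁ _ α₁ Fe₂ _ α₂ θ β hβ u heq
    obtain ⟨b₁, c₁⟩ := bc₁
    obtain ⟨b₂, c₂⟩ := bc₂
    change b₁ = b at p₁
    change b₂ = b at p₂
    subst p₂
    subst p₁
    -- the two components of `T_e` are distinct
    have hpne : A.brComp ⟨b₁, c₁⟩ ≠ A.brComp ⟨b₁, c₂⟩ := by
      intro h
      exact hne (Sigma.ext rfl (heq_of_eq ((equivShrink _).symm.injective h)))
    -- notation
    let v := A.fibreData.proj.vertexMap vc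
    let P : Subobject (A.S v) := (A.vComp vc).1
    haveI : PreGaloisCategory.IsConnected (P : 𝒢.V v) := (A.vComp vc).2
    let eP := Shrink.equivalence (Over (P : 𝒢.V v))
    let Pb := (𝒢.pull b₁ v (abuts_fst h₁)).pullback
    let R₁ := (A.coveringHomCan.φE (A.fibreData.total.edgeOf ⟨b₁, c₁⟩) (𝒢.graph.edgeOf b₁)
      (A.fibreData.proj.edgeOf_branchMap ⟨b₁, c₁⟩).symm).pullback
    let R₂ := (A.coveringHomCan.φE (A.fibreData.total.edgeOf ⟨b₁, c₂⟩) (𝒢.graph.edgeOf b₁)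
      (A.fibreData.proj.edgeOf_branchMap ⟨b₁, c₂⟩).symm).pullback
    let m₁ := A.inclOfLE (abuts_fst h₁) P (A.brComp ⟨b₁, c₁⟩).1 (brComp_le_branchImage h₁)
    let m₂ := A.inclOfLE (abuts_fst h₂) P (A.brComp ⟨b₁, c₂⟩).1 (brComp_le_branchImage h₂)
    haveI : FiberFunctor (R₁ ⋙ Fe₁) := fiberFunctor_comp_of_exact _ _
    -- base points
    obtain ⟨t⟩ := A.nonempty_fiber_mkId_vModel vc F'
    obtain ⟨t'₁⟩ := A.nonempty_fiber_mkId_eModel (A.fibreData.total.edgeOf ⟨b₁, c₁⟩) Fe₁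
    obtain ⟨t'₂⟩ := A.nonempty_fiber_mkId_eModel (A.fibreData.total.edgeOf ⟨b₁, c₂⟩) Fe₂
    let s₀ : ((A.coveringHomCan.φV vc).pullback ⋙ F').obj (P : 𝒢.V v) :=
      F'.map (eP.functor.map (diagSection _)) t
    let t₀₁ : (R₁ ⋙ Fe₁).obj ((A.brComp ⟨b₁, c₁⟩).1 :
        𝒢.E (𝒢.graph.edgeOf (A.fibreData.proj.branchMap ⟨b₁, c₁⟩))) :=
      Fe₁.map ((Shrink.equivalence (Over ((A.brComp ⟨b₁, c₁⟩).1 :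
        𝒢.E (𝒢.graph.edgeOf (A.fibreData.proj.branchMap ⟨b₁, c₁⟩))))).functor.map (diagSection _)) t'₁
    let t₀₂ : (R₂ ⋙ Fe₂).obj ((A.brComp ⟨b₁, c₂⟩).1 :
        𝒢.E (𝒢.graph.edgeOf (A.fibreData.proj.branchMap ⟨b₁, c₂⟩))) :=
      Fe₂.map ((Shrink.equivalence (Over ((A.brComp ⟨b₁, c₂⟩).1 :
        𝒢.E (𝒢.graph.edgeOf (A.fibreData.proj.branchMap ⟨b₁, c₂⟩))))).functor.map (diagSection _)) t'₂
    have hs : (pi1Map (A.coveringHomCan.φV vc).pullback F' u).hom.app (P : 𝒢.V v) s₀ = s₀ := by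
      have := A.range_pi1Map_vertexHom_le_stabilizer vc F' t ⟨u, rfl⟩
      rwa [MulAction.mem_stabilizer_iff, mulAction_def] at this
    have hpt₁ := A.alignIso_point ⟨b₁, c₁⟩ vc h₁ F' Fe₁ α₁ t t'₁
    have hpt₂ := A.alignIso_point ⟨b₁, c₂⟩ vc h₂ F' Fe₂ α₂ t t'₂
    -- the frames
    let γ₁ := A.coveringHomCan.alignIso ⟨b₁, c₁⟩ vc h₁ b₁ rfl F' Fe₁ α₁
    let γ₂ := A.coveringHomCan.alignIso ⟨b₁, c₂⟩ vc h₂ b₁ rfl F' Fe₂ α₂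
    change γ₁.hom.app (P : 𝒢.V v) ((R₁ ⋙ Fe₁).map m₁ t₀₁) = s₀ at hpt₁
    change γ₂.hom.app (P : 𝒢.V v) ((R₂ ⋙ Fe₂).map m₂ t₀₂) = s₀ at hpt₂
    have hinv₁ : γ₁.inv.app (P : 𝒢.V v) s₀ = (R₁ ⋙ Fe₁).map m₁ t₀₁ := by
      rw [← hpt₁]
      exact FintypeCat.hom_inv_id_apply (γ₁.app _) _
    have hinv₂ : γ₂.inv.app (P : 𝒢.V v) s₀ = (R₂ ⋙ Fe₂).map m₂ t₀₂ := by
      rw [← hpt₂]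
      exact FintypeCat.hom_inv_id_apply (γ₂.app _) _
    -- `β = γ₁(π₁(b^*)(σ))`
    obtain ⟨σ, rfl⟩ := hβ
    -- evaluate `t = β · ι u` at `s₀`
    have hev := congrArg (fun g : Aut ((A.coveringHomCan.φV vc).pullback ⋙ F') =>
      g.hom.app (P : 𝒢.V v) s₀) heq
    change γ₁.hom.app (P : 𝒢.V v) (θ.hom.app (Pb.obj (P : 𝒢.V v)) (γ₂.inv.app (P : 𝒢.V v) s₀)) =
      (γ₁.inv ≫ (pi1Map Pb (R₁ ⋙ Fe₁) σ).hom ≫ γ₁.hom).app (P : 𝒢.V v)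
        ((pi1Map (A.coveringHomCan.φV vc).pullback F' u).hom.app (P : 𝒢.V v) s₀) at hev
    rw [hs, hinv₂, NatTrans.comp_app, NatTrans.comp_app, FintypeCat.comp_apply,
      FintypeCat.comp_apply, hinv₁, pi1Map_hom_app] at hev
    -- cancel `γ₁` and move both sides into the fibre of `T_e` under `R₁ ⋙ F_e₁`
    have hev' : θ.hom.app (Pb.obj (P : 𝒢.V v)) ((R₂ ⋙ Fe₂).map m₂ t₀₂) =
        σ.hom.app (Pb.obj (P : 𝒢.V v)) ((R₁ ⋙ Fe₁).map m₁ t₀₁) :=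
      (FintypeCat.equivEquivIso.symm (γ₁.app (P : 𝒢.V v))).injective hev
    have hθnat := FunctorToFintypeCat.naturality (R₂ ⋙ Fe₂) (R₁ ⋙ Fe₁) θ.hom m₂ t₀₂
    have hσnat := FunctorToFintypeCat.naturality (R₁ ⋙ Fe₁) (R₁ ⋙ Fe₁) σ.hom m₁ t₀₁
    have hev'' : (R₁ ⋙ Fe₁).map m₂ (θ.hom.app _ t₀₂) = (R₁ ⋙ Fe₁).map m₁ (σ.hom.app _ t₀₁) :=
      hθnat.symm.trans (hev'.trans hσnat)
    -- `θ(t₀₂)` maps into the image of `Q₂`, `σ(t₀₁)` into the image of `Q₁`: push along `b^*P ↪ T_e`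
    have hj₁ : m₁ ≫ (Pb.map P.arrow ≫ (A.ψ b₁ v (abuts_fst h₁)).hom) = (A.brComp ⟨b₁, c₁⟩).1.arrow :=
      A.inclOfLE_comp _ _ _ _
    have hj₂ : m₂ ≫ (Pb.map P.arrow ≫ (A.ψ b₁ v (abuts_fst h₁)).hom) = (A.brComp ⟨b₁, c₂⟩).1.arrow :=
      A.inclOfLE_comp _ _ _ _
    have hpt : (R₁ ⋙ Fe₁).map (A.brComp ⟨b₁, c₂⟩).1.arrow (θ.hom.app _ t₀₂) =
        (R₁ ⋙ Fe₁).map (A.brComp ⟨b₁, c₁⟩).1.arrow (σ.hom.app _ t₀₁) := by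
      rw [← hj₁, ← hj₂]
      simp only [Functor.map_comp, FintypeCat.comp_apply]
      rw [hev'']
      rfl
    exact hpne ((component_eq_of_mem_range (R₁ ⋙ Fe₁) (A.brComp ⟨b₁, c₁⟩) (A.brComp ⟨b₁, c₂⟩)
      ⟨_, rfl⟩ ⟨_, hpt⟩))

/-- **The covering `coveringHom A : 𝒢_A → 𝒢` of `CoveringOfObject.lean` is branch-aligned** as
well: it EQUALS `coveringHomCan A` (abc-iut-w4-d096's `coveringHomCan_eq_coveringHom`, the two 2-cell
packages coincide). [cite: MochizukiSemiAnbd2006, Def. 2.2(i) p.23] -/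
theorem coveringHom_isBranchAligned : A.coveringHom.IsBranchAligned :=
  A.coveringHomCan_eq_coveringHom ▸ A.coveringHomCan_isBranchAligned

end BObj

end SemiGraphOfAnabelioids

end Literature.AnabelianGeometry.SemiGraphs
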